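import Literature.NumberTheory.EllipticCurves.HeegnerEnvelopeReverseProofs
import HarnessLib

/-!
# The Heegner-module envelope, REVERSE direction with the TWISTED levelwise hypothesis:
# `(conj_{γ^{p^δ}} − 1) κ_k ∈ ℋ̄_k(F)` for `k > δ` ⟹ `ω_δ • Λκ_∞(C) ≤ ℋ_∞(F)` (proofs file)

Topic `NumberTheory/EllipticCurves`. THEOREMS ONLY (no definition, no named fact, no `sorry`); a variant of
`HeegnerEnvelopeReverseProofs` §3 (seat x9-p2: hypothesis `p^e • x ∈ ℋ̄_k(F)` for the representatives `x` of
`δ(κ_k)`). Written by the cell `bsd-print-x9` seat `bsd-line-x9-p1-w2` for the reverse half of the module-level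
envelope stub of the crux `PrintX9.HowardContainmentLightFramePinnedOfPrint[Sharp]`: the geometric side
(`HeegnerGeomShiftedNormsInHowardSpanProofs.exists_int_not_dvd_smul_mem_span_of_shifted`) delivers `u_k`, `v_k`
in the `ℤ`-span of Howard's `z_j` only UP TO a `K_δ`-rational point, which `conj_{γ^{p^δ}} − 1` kills; so the
levelwise input available at EVERY class number is the TWISTED membership
`conj_{γ^{p^δ}}(x) − x ∈ ℋ̄_k(F)` (`x` a representative of `δ(κ_k)`, `k > δ`), and this file shows it suffices
for `ω_δ • Λκ_∞(C) ≤ ℋ_∞(F)`, `ω_δ = (1+T)^{p^δ} − 1 ≠ 0` — the proof of x9-p2's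
`omega_mul_pow_smul_stabilizedHeegnerModule_le_heegnerModule_of_levelwise` verbatim, with the twist moved into
the hypothesis and `ℤ_p[G_k]`-linearity of `conj_{γ^{p^δ}} − 1` (`conjPi_mul`, `conjPi_padicPi_comm`).

* `conjPi_sub_self_mem_heegnerModuleLayer_of_generators` — the twisted membership passes from the
  representatives of `δ(κ_k)` to all of `ℤ_p[G_k]·δ(κ_k)` (`stabilizedModuleLayer`).
* `omega_smul_stabilizedHeegnerModule_le_heegnerModule_of_twisted_levelwise` / `…_of_twisted_generators` —
  `ω_δ • Λκ_∞(C) ≤ ℋ_∞(F)`.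
HONEST FRAMING: bookkeeping only; nothing about any particular curve; BSD is not proved by any of this.

References: [CastellaGrossiLeeSkinner2022] Rem. 4.1.4 («κ_∞ and κ₁^{Hg} generate the same Λ-submodule»);
[PerrinRiou1987BSMF] §3.4 Prop. 10; [Howard2004HeegnerKolyvagin] §3.3 Thm. 3.3.7; [Washington1997] §13.2 (ω_n).
-/

set_option autoImplicit false

noncomputable section

open scoped Classical Pointwise

open WeierstrassCurve Literature.NumberTheory.EllipticCurves
  Literature.NumberTheory.EllipticCurves.CastellaGrossiLeeSkinner2022 PowerSeries

universe u

namespace Literature.NumberTheory.EllipticCurves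

section Twisted

variable {N : ℕ} [NeZero N] {W : WeierstrassCurve ℚ} [W.IsGloballyMinimal] {K : Type u} [Field K]
  [NumberField K] {p : ℕ} [Fact p.Prime] {κ : ZpExtension K p} {γ : Field.absoluteGaloisGroup K}
  {jbar : AlgebraicClosure K →+* ℂ} (D : (W.baseChange K).LambdaAdicSelmerData κ γ)
  (F : HeegnerFamily N W K κ jbar) (C : StabilizedHeegnerData N W K κ jbar)

/-- **From the representatives to the module**: if `conj_{γ^t}(x) − x ∈ ℋ̄_k(F)` for the representatives `x` of
`δ(κ_k)`, then `conj_{γ^t}(y) − y ∈ ℋ̄_k(F)` for every `y ∈ ℤ_p[G_k]·δ(κ_k)` — `conj_{γ^t} − 1` commutes with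
`c ·` and `conj_{γ^i}`, and `ℋ̄_k(F)` is `ℤ_p[G_k]`-stable. [cite: Howard2004HeegnerKolyvagin, §3.3 (H_k is a ℤ_p[Gal(K_k/K)]-module)] -/
theorem conjPi_sub_self_mem_heegnerModuleLayer_of_generators (t : ℕ) {k : ℕ} (hk : C.depth < k)
    (hgen : ∀ x ∈ stabilizedClassLayer C k hk,
      (W.baseChange K).conjPi p (κ.layerSubgroup k) (γ ^ t) x - x ∈ heegnerModuleLayer γ F k)
    {y : (W.baseChange K).torsionH1Pi p (κ.layerSubgroup k)} (hy : y ∈ stabilizedModuleLayer γ C k hk) :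
    (W.baseChange K).conjPi p (κ.layerSubgroup k) (γ ^ t) y - y ∈ heegnerModuleLayer γ F k := by
  unfold stabilizedModuleLayer at hy
  induction hy using AddSubgroup.closure_induction with
  | mem z hz =>
    obtain ⟨c, i, x, hx, rfl⟩ := hz
    rw [conjPi_padicPi_comm, ← map_sub, ← conjPi_mul, ← pow_add, add_comm, pow_add, conjPi_mul,
      ← map_sub]
    exact padicPi_mem_heegnerModuleLayer γ F k c (conjPi_pow_mem_heegnerModuleLayer γ F k i (hgen x hx))
  | zero => rw [map_zero, sub_zero]; exact AddSubgroup.zero_mem _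
  | add a b _ _ ha hb =>
    rw [map_add, add_sub_add_comm]; exact AddSubgroup.add_mem _ ha hb
  | neg a _ ha =>
    rw [map_neg, show -((W.baseChange K).conjPi p (κ.layerSubgroup k) (γ ^ t) a) - -a =
      -((W.baseChange K).conjPi p (κ.layerSubgroup k) (γ ^ t) a - a) by abel]
    exact AddSubgroup.neg_mem _ ha

/-- **REVERSE, twisted levelwise ⟹ Λ-adic.** Let `γ` be a topological generator and `δ` the torsion depth of
`C`. If `conj_{γ^{p^δ}}(y) − y ∈ ℋ̄_k(F)` for every layer `k > δ` and every `y ∈ ℤ_p[G_k]·κ_k(C)`, then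
`ω_δ • Λκ_∞(C) ≤ ℋ_∞(F)`, `ω_δ = (1+T)^{p^δ} − 1`: for a spanning `s` of `Λκ_∞(C)`, `proj_k(ω_δ • s)` VANISHES
for `k ≤ δ` and equals `conj_{γ^{p^δ}}(proj_k s) − proj_k s ∈ ℋ̄_k(F)` for `k > δ`.
[cite: CastellaGrossiLeeSkinner2022, Rem. 4.1.4 («generate the same Λ-submodule»)] [cite: PerrinRiou1987BSMF, §3.4 Prop. 10] -/
theorem omega_smul_stabilizedHeegnerModule_le_heegnerModule_of_twisted_levelwise
    (hγ : κ.IsTopGenerator γ)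
    (hlev : ∀ (k : ℕ) (hk : C.depth < k), ∀ y ∈ stabilizedModuleLayer γ C k hk,
      (W.baseChange K).conjPi p (κ.layerSubgroup k) (γ ^ (p ^ C.depth)) y - y ∈ heegnerModuleLayer γ F k) :
    (((1 + PowerSeries.X : IwasawaAlgebra p) ^ (p ^ C.depth)) - 1) • stabilizedHeegnerModule D C ≤
      heegnerModule D F := by
  intro t ht
  obtain ⟨s, hs, rfl⟩ := (Submodule.mem_smul_pointwise_iff_exists _ _ _).mp ht
  clear ht
  unfold stabilizedHeegnerModule at hs
  induction hs using Submodule.span_induction with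
  | mem g hg =>
    refine Submodule.subset_span fun k ↦ ?_
    by_cases hk : C.depth < k
    · rw [sub_smul, one_smul, map_sub, proj_one_add_X_pow_smul]
      exact hlev k hk _ (hg k hk)
    · rw [proj_one_add_X_pow_pow_sub_one_smul_of_le D hγ (not_lt.mp hk)]
      exact (heegnerModuleLayer γ F k).zero_mem
  | zero => rw [smul_zero]; exact Submodule.zero_mem _
  | add a b _ _ ha hb => rw [smul_add]; exact Submodule.add_mem _ ha hb
  | smul r a _ ha => rw [smul_comm]; exact Submodule.smul_mem _ r ha

/-- **Generators suffice (twisted reverse)**: it is enough that `conj_{γ^{p^δ}}(x) − x ∈ ℋ̄_k(F)` for the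
representatives `x` of CGLS's level class `δ(κ_k)` (`stabilizedClassLayer`), `k > δ`. This is the input the
geometric side delivers at every class number (`u_k`, `v_k` in the `ℤ`-span of the `z_j` up to a `p`-adic unit
and a `K_δ`-rational point, `HeegnerGeomShiftedNormsInHowardSpanProofs`).
[cite: CastellaGrossiLeeSkinner2022, Rem. 4.1.4 (κ_k)] [cite: Howard2004HeegnerKolyvagin, §3.3, Thm. 3.3.7] -/
theorem omega_smul_stabilizedHeegnerModule_le_heegnerModule_of_twisted_generators
    (hγ : κ.IsTopGenerator γ)
    (hgen : ∀ (k : ℕ) (hk : C.depth < k), ∀ x ∈ stabilizedClassLayer C k hk,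
      (W.baseChange K).conjPi p (κ.layerSubgroup k) (γ ^ (p ^ C.depth)) x - x ∈ heegnerModuleLayer γ F k) :
    (((1 + PowerSeries.X : IwasawaAlgebra p) ^ (p ^ C.depth)) - 1) • stabilizedHeegnerModule D C ≤
      heegnerModule D F :=
  omega_smul_stabilizedHeegnerModule_le_heegnerModule_of_twisted_levelwise D F C hγ fun k hk _ hy ↦
    conjPi_sub_self_mem_heegnerModuleLayer_of_generators F C _ hk (hgen k hk) hy

/-- `ω_δ ≠ 0` in `Λ` (its reduction mod `p` is non-zero, `map_omega_ne_zero`). [cite: Washington1997, §13.2 (ω_n is distinguished)] -/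
theorem omega_ne_zero (n : ℕ) : (((1 + PowerSeries.X : IwasawaAlgebra p) ^ (p ^ n)) - 1) ≠ 0 := by
  intro h
  have hc := congrArg (PowerSeries.map (IsLocalRing.residue ℤ_[p])) h
  rw [map_zero] at hc
  exact map_omega_ne_zero (p := p) n hc

end Twisted

end Literature.NumberTheory.EllipticCurves

end
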